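import Mathlib
import Literature.NumberTheory.Automorphic.HilbertModularFormQExpansion
import Literature.Analysis.Complex.OsgoodProofs
import Summits.Langlands.Langlands.Theorems.CapacityClassicalityHilbertIntegralOverconvergentIsCongruenceKoecherGlue

/-!
# The cube-coordinate function `x ↦ f(x + iy)` of a holomorphic `f` is real `C^∞`

Stub L2a (`stub_contDiff_cube`) of line Sketch-ideate-r1-k1 for the crux
`HilbertIntegralOverconvergentIsCongruence` (stmt-Langlands-8485).  Section L of the line expands a
holomorphic `𝓞 F`-periodic `f` on the tube domain `ℍ = halfSpace F ⊆ ℂ^{Hom(F,ℝ)}` (Freitag, *Hilbert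
Modular Forms*, Ch. I Lemma 4.1) through the torus Fourier theory of the cube-coordinate function
`g_y : x ↦ f (cubePoint x y)`, `x ∈ ℝ^ι`, which must be real `C^∞`.  Proof: `ℍ` is open
(`isOpen_halfSpace`), so by Osgood's lemma (`Literature.Analysis.Complex.osgoodLemma_holds`) the
complex-differentiable `f` is analytic, hence `C^∞` over `ℂ` on `ℍ`, hence over `ℝ`
(`ContDiffOn.restrict_scalars`); and `x ↦ cubePoint x y` is a real-affine (so `C^∞`) map of `ℝ^ι` into
`ℍ` for `y ≫ 0` (`koe_cubePoint_mem_halfSpace`), so the composite is `C^∞` (`ContDiffOn.comp_contDiff`).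
-/

set_option linter.dupNamespace false

noncomputable section

namespace Summit.Langlands.Langlands.Theorems.HilbertIntegralOverconvergentIsCongruence

open MeasureTheory Complex NumberField
open Literature.NumberTheory.Automorphic Literature.NumberTheory.Automorphic.HilbertModular

variable {F : Type} [Field F] [NumberField F]

/-- Each real coordinate `x ↦ x_σ = ∑_i x_i σ(b_i)` of the real point is real `C^n` (it is linear). -/
theorem koe_contDiff_realPoint (σ : F →+* ℝ) {n : WithTop ℕ∞} :
    ContDiff ℝ n fun x : Coord F ↦ realPoint x σ :=
  ContDiff.sum fun i _ ↦ (contDiff_apply ℝ ℝ i).mul contDiff_const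

/-- `x ↦ x + iy` is real `C^n` (indeed affine) in the cube coordinates. -/
theorem koe_contDiff_cubePoint (y : (F →+* ℝ) → ℝ) {n : WithTop ℕ∞} :
    ContDiff ℝ n fun x : Coord F ↦ cubePoint x y :=
  contDiff_pi.2 fun σ ↦
    (ofRealCLM.contDiff.comp (koe_contDiff_realPoint σ)).add contDiff_const

/-- A function holomorphic on `ℍ` is real `C^n` on `ℍ` for every `n` (Osgood: holomorphic on the open set
`ℍ` of the finite-dimensional space `ℂ^{Hom(F,ℝ)}` ⇒ analytic ⇒ `C^ω` over `ℂ`; then restrict scalars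
to `ℝ`). -/
theorem koe_contDiffOn_real_of_isHolomorphicOn {f : Point F → ℂ} (hf : IsHolomorphicOn F f)
    {n : WithTop ℕ∞} : ContDiffOn ℝ n f (halfSpace F) :=
  ((Literature.Analysis.Complex.osgoodLemma_holds (Point F) isOpen_halfSpace
    hf).contDiffOn_of_completeSpace).restrict_scalars ℝ

/-- **stub L2a — `stub_contDiff_cube`.** For `f` holomorphic on `ℍ` and a height `y ≫ 0`, the
cube-coordinate function `x ↦ f(x + iy)` is real `C^∞` on all of `ℝ^ι` (`ℍ` is open, `f` is analytic
hence `C^∞` there, and `x ↦ x + iy` is a `C^∞` affine map into `ℍ`). [folklore] -/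
theorem stub_contDiff_cube (F : Type) [Field F] [NumberField F] (f : Point F → ℂ) (hf : IsHolomorphicOn F f)
    (y : (F →+* ℝ) → ℝ) (hy : ∀ σ, 0 < y σ) :
    ContDiff ℝ (⊤ : ℕ∞) (fun x : Coord F ↦ f (cubePoint x y)) :=
  (koe_contDiffOn_real_of_isHolomorphicOn hf).comp_contDiff (koe_contDiff_cubePoint y)
    fun x ↦ koe_cubePoint_mem_halfSpace x hy

end Summit.Langlands.Langlands.Theorems.HilbertIntegralOverconvergentIsCongruence
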